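import Mathlib
import HarnessLib
import Summits.AtomisticToContinuum.Crystallization.Theorems.PricedLinkCensusSoftFourRingsCube3

/-!
# Soft four-rings, endgame: every vertex of type O generates the cuboctahedron

Support file for `SoftFourRings` (route `PricedLinkCensus`, sub-problem `Crystallization`),
endgame step (E5) of the evidence file (§12.8), point-level form, every vertex of type O.

`cube_structure` : from type-O data at a vertex `v`, twelve distinct points
`v, x, y, z, a, c, b', d', b, d, a', c'` exhaust `X` and have exactly the neighbourhoods of the
cuboctahedron, listed in the order of `fccTab` of the Literature (`labelling_fcc`).
-/

namespace Summit.AtomisticToContinuum.Crystallization.Theorems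

open Real RealInnerProductSpace Literature.Geometry.DiscreteGeometry

section Setting

variable {X : Finset (EuclideanSpace ℝ (Fin 3))} {B : Finset (Finset (EuclideanSpace ℝ (Fin 3)))}
  (hT : musinTarasov2012_tammes_thirteen) (hX1 : ∀ y ∈ X, ‖y‖ = 1) (hcard : X.card = 12)
  (hsepX : ∀ u ∈ X, ∀ u' ∈ X, u ≠ u' → ⟪u, u'⟫ ≤ 1 - 1 / (2 * (101 / 100 : ℝ) ^ 2))
  (hB : ∀ T ∈ B, ∃ u ∈ X, ∃ u' ∈ X, u ≠ u' ∧ 1 - (101 / 100 : ℝ) ^ 2 / 2 ≤ ⟪u, u'⟫ ∧ T = {u, u'})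
  (hBcard : B.card = 24)
  (hdeg : ∀ v ∈ X, ∃ w : Fin 4 → EuclideanSpace ℝ (Fin 3), (∀ k, w k ∈ X) ∧
    Function.Injective w ∧ (∀ k, w k ≠ v) ∧
    (∀ k, ({v, w k} : Finset (EuclideanSpace ℝ (Fin 3))) ∈ B) ∧
    ∀ y, ({v, y} : Finset (EuclideanSpace ℝ (Fin 3))) ∈ B → ∃ k, y = w k)
  (hallO : ∀ u ∈ X, ∃ a b c d : EuclideanSpace ℝ (Fin 3), (∀ t, ({u, t} : Finset (EuclideanSpace ℝ (Fin 3))) ∈ B ↔ (t = a ∨ t = b ∨ t = c ∨ t = d)) ∧ (a ≠ b ∧ a ≠ c ∧ a ≠ d ∧ b ≠ c ∧ b ≠ d ∧ c ≠ d) ∧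
    ({a, b} : Finset (EuclideanSpace ℝ (Fin 3))) ∈ B ∧ ({c, d} : Finset (EuclideanSpace ℝ (Fin 3))) ∈ B ∧ ({a, c} : Finset (EuclideanSpace ℝ (Fin 3))) ∉ B ∧ ({a, d} : Finset (EuclideanSpace ℝ (Fin 3))) ∉ B ∧ ({b, c} : Finset (EuclideanSpace ℝ (Fin 3))) ∉ B ∧ ({b, d} : Finset (EuclideanSpace ℝ (Fin 3))) ∉ B)

include hT hX1 hcard hsepX hB hBcard hdeg hallO in
open scoped Classical in
/-- **A type-O vertex generates the cuboctahedron** when every vertex is of type O. -/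
theorem cube_structure {v a₀ b₀ c₀ d₀ : EuclideanSpace ℝ (Fin 3)} (hv : v ∈ X)
    (hN₀ : (∀ t, ({v, t} : Finset (EuclideanSpace ℝ (Fin 3))) ∈ B ↔ (t = a₀ ∨ t = b₀ ∨ t = c₀ ∨ t = d₀))) (hd₀ : (a₀ ≠ b₀ ∧ a₀ ≠ c₀ ∧ a₀ ≠ d₀ ∧ b₀ ≠ c₀ ∧ b₀ ≠ d₀ ∧ c₀ ≠ d₀))
    (hab₀ : ({a₀, b₀} : Finset (EuclideanSpace ℝ (Fin 3))) ∈ B) (hcd₀ : ({c₀, d₀} : Finset (EuclideanSpace ℝ (Fin 3))) ∈ B)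
    (hac₀ : ({a₀, c₀} : Finset (EuclideanSpace ℝ (Fin 3))) ∉ B) (had₀ : ({a₀, d₀} : Finset (EuclideanSpace ℝ (Fin 3))) ∉ B) (hbc₀ : ({b₀, c₀} : Finset (EuclideanSpace ℝ (Fin 3))) ∉ B) (hbd₀ : ({b₀, d₀} : Finset (EuclideanSpace ℝ (Fin 3))) ∉ B) :
    ∃ x y z a c b' d' b d a' c' : EuclideanSpace ℝ (Fin 3),
      [v, x, y, z, a, c, b', d', b, d, a', c'].Nodup ∧
      (∀ u, u ∈ X ↔ u ∈ [v, x, y, z, a, c, b', d', b, d, a', c']) ∧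
      (∀ t, ({v, t} : Finset (EuclideanSpace ℝ (Fin 3))) ∈ B ↔ (t = a ∨ t = c ∨ t = b ∨ t = d)) ∧ (∀ t, ({x, t} : Finset (EuclideanSpace ℝ (Fin 3))) ∈ B ↔ (t = a ∨ t = c ∨ t = a' ∨ t = c')) ∧ (∀ t, ({y, t} : Finset (EuclideanSpace ℝ (Fin 3))) ∈ B ↔ (t = b' ∨ t = d' ∨ t = b ∨ t = d)) ∧ (∀ t, ({z, t} : Finset (EuclideanSpace ℝ (Fin 3))) ∈ B ↔ (t = b' ∨ t = d' ∨ t = a' ∨ t = c')) ∧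
      (∀ t, ({a, t} : Finset (EuclideanSpace ℝ (Fin 3))) ∈ B ↔ (t = v ∨ t = x ∨ t = b ∨ t = a')) ∧ (∀ t, ({c, t} : Finset (EuclideanSpace ℝ (Fin 3))) ∈ B ↔ (t = v ∨ t = x ∨ t = d ∨ t = c')) ∧ (∀ t, ({b', t} : Finset (EuclideanSpace ℝ (Fin 3))) ∈ B ↔ (t = y ∨ t = z ∨ t = b ∨ t = a')) ∧ (∀ t, ({d', t} : Finset (EuclideanSpace ℝ (Fin 3))) ∈ B ↔ (t = y ∨ t = z ∨ t = d ∨ t = c')) ∧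
      (∀ t, ({b, t} : Finset (EuclideanSpace ℝ (Fin 3))) ∈ B ↔ (t = v ∨ t = y ∨ t = a ∨ t = b')) ∧ (∀ t, ({d, t} : Finset (EuclideanSpace ℝ (Fin 3))) ∈ B ↔ (t = v ∨ t = y ∨ t = c ∨ t = d')) ∧ (∀ t, ({a', t} : Finset (EuclideanSpace ℝ (Fin 3))) ∈ B ↔ (t = x ∨ t = z ∨ t = a ∨ t = b')) ∧ (∀ t, ({c', t} : Finset (EuclideanSpace ℝ (Fin 3))) ∈ B ↔ (t = x ∨ t = z ∨ t = c ∨ t = d')) := by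
  -- the frame
  obtain ⟨c, d, x, y, a', b', c', d', ⟨hN, hd, hab, hcd, hac, had, hbc, hbd⟩,
    ⟨hNa, hda, hxa', hvxn, hvapn, hbxn, hbapn⟩, ⟨hNb, hdb, hyb', hvyn, hvbpn, hayn, habpn⟩,
    ⟨hNc, hdc, hxc', hvxn', hvcpn, hdxn, hdcpn⟩, ⟨hNd, hdd, hyd', hvyn', hvdpn, hcyn, hcdpn⟩,
    ⟨hNx, hdxx, hacx, hacpn, hapcn, hapcpn⟩, ⟨hNy, hdyy, hbdy, hbdpn, hbpdn, hbpdpn⟩,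
    ⟨hxX, hyX, hxv, hxa, hxb, hxc, hxd, hyv, hya, hyb, hyc, hyd, hxy⟩⟩ :=
    cube_frame hT hX1 hcard hsepX hB hBcard hdeg hallO hv hN₀ hd₀ hab₀ hcd₀ hac₀ had₀ hbc₀ hbd₀
  set a := a₀ with ha₀
  set b := b₀ with hb₀
  -- the pairings, from both sides
  have hapbp : ({a', b'} : Finset (EuclideanSpace ℝ (Fin 3))) ∈ B :=
    cube_pairing hT hX1 hcard hsepX hB hBcard hdeg hallO hv hN hd hab hcd hac had hbc hbd hNa hda hxa'
      hvxn hvapn hbxn hbapn hNb hdb hyb' hvyn hvbpn hayn habpn hNc hdc hxc' hvcpn hdxn hdcpn hNd hdd hyd'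
      hvdpn hcyn hcdpn hNx hdxx hacpn hapcn hapcpn hNy hdyy hbdpn hbpdn hbpdpn hxX hyX hxv hxa hxb hxc
      hxd hyv hya hyb hyc hyd hxy
  have hapdp : a' ≠ d' :=
    frame_ne hcard hB hdeg hallO hv hN hd hab hcd hac had hbc hbd hNa hda hxa'
      hvxn hvapn hbxn hbapn hNb hdb hyb' hvyn hvbpn hayn habpn hNc hdc hxc' hvcpn hdxn hdcpn hNd hdd hyd'
      hvdpn hcyn hcdpn hNx hdxx hacpn hapcn hapcpn hNy hdyy hbdpn hbpdn hbpdpn hxX hyX hxv hxa hxb hxc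
      hxd hyv hya hyb hyc hyd hxy
  -- the same with `(a, b, a', b')` and `(c, d, c', d')` exchanged
  have hN' : (∀ t, ({v, t} : Finset (EuclideanSpace ℝ (Fin 3))) ∈ B ↔ (t = c ∨ t = d ∨ t = a ∨ t = b)) := (fun t => (hN t).trans ⟨by rintro (h | h | h | h); exacts [Or.inr (Or.inr (Or.inl h)), Or.inr (Or.inr (Or.inr h)), Or.inl h, Or.inr (Or.inl h)], by rintro (h | h | h | h); exacts [Or.inr (Or.inr (Or.inl h)), Or.inr (Or.inr (Or.inr h)), Or.inl h, Or.inr (Or.inl h)]⟩)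
  have hd' : (c ≠ d ∧ c ≠ a ∧ c ≠ b ∧ d ≠ a ∧ d ≠ b ∧ a ≠ b) :=
    ⟨hd.2.2.2.2.2, hd.2.1.symm, hd.2.2.2.1.symm, hd.2.2.1.symm, hd.2.2.2.2.1.symm, hd.1⟩
  have hNx' : (∀ t, ({x, t} : Finset (EuclideanSpace ℝ (Fin 3))) ∈ B ↔ (t = c ∨ t = c' ∨ t = a ∨ t = a')) := (fun t => (hNx t).trans ⟨by rintro (h | h | h | h); exacts [Or.inr (Or.inr (Or.inl h)), Or.inr (Or.inr (Or.inr h)), Or.inl h, Or.inr (Or.inl h)], by rintro (h | h | h | h); exacts [Or.inr (Or.inr (Or.inl h)), Or.inr (Or.inr (Or.inr h)), Or.inl h, Or.inr (Or.inl h)]⟩)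
  have hdxx' : (c ≠ c' ∧ c ≠ a ∧ c ≠ a' ∧ c' ≠ a ∧ c' ≠ a' ∧ a ≠ a') :=
    ⟨hdxx.2.2.2.2.2, hdxx.2.1.symm, hdxx.2.2.2.1.symm, hdxx.2.2.1.symm, hdxx.2.2.2.2.1.symm, hdxx.1⟩
  have hNy' : (∀ t, ({y, t} : Finset (EuclideanSpace ℝ (Fin 3))) ∈ B ↔ (t = d ∨ t = d' ∨ t = b ∨ t = b')) := (fun t => (hNy t).trans ⟨by rintro (h | h | h | h); exacts [Or.inr (Or.inr (Or.inl h)), Or.inr (Or.inr (Or.inr h)), Or.inl h, Or.inr (Or.inl h)], by rintro (h | h | h | h); exacts [Or.inr (Or.inr (Or.inl h)), Or.inr (Or.inr (Or.inr h)), Or.inl h, Or.inr (Or.inl h)]⟩)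
  have hdyy' : (d ≠ d' ∧ d ≠ b ∧ d ≠ b' ∧ d' ≠ b ∧ d' ≠ b' ∧ b ≠ b') :=
    ⟨hdyy.2.2.2.2.2, hdyy.2.1.symm, hdyy.2.2.2.1.symm, hdyy.2.2.1.symm, hdyy.2.2.2.2.1.symm, hdyy.1⟩
  have hca : ({c, a} : Finset (EuclideanSpace ℝ (Fin 3))) ∉ B := fun h => hac (by rw [Finset.pair_comm]; exact h)
  have hcb : ({c, b} : Finset (EuclideanSpace ℝ (Fin 3))) ∉ B := fun h => hbc (by rw [Finset.pair_comm]; exact h)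
  have hda'' : ({d, a} : Finset (EuclideanSpace ℝ (Fin 3))) ∉ B := fun h => had (by rw [Finset.pair_comm]; exact h)
  have hdb'' : ({d, b} : Finset (EuclideanSpace ℝ (Fin 3))) ∉ B := fun h => hbd (by rw [Finset.pair_comm]; exact h)
  have hcap : ({c, a'} : Finset (EuclideanSpace ℝ (Fin 3))) ∉ B := fun h => hapcn (by rw [Finset.pair_comm]; exact h)
  have hcpa : ({c', a} : Finset (EuclideanSpace ℝ (Fin 3))) ∉ B := fun h => hacpn (by rw [Finset.pair_comm]; exact h)
  have hcpap : ({c', a'} : Finset (EuclideanSpace ℝ (Fin 3))) ∉ B := fun h => hapcpn (by rw [Finset.pair_comm]; exact h)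
  have hdbp : ({d, b'} : Finset (EuclideanSpace ℝ (Fin 3))) ∉ B := fun h => hbpdn (by rw [Finset.pair_comm]; exact h)
  have hdpb : ({d', b} : Finset (EuclideanSpace ℝ (Fin 3))) ∉ B := fun h => hbdpn (by rw [Finset.pair_comm]; exact h)
  have hdpbp : ({d', b'} : Finset (EuclideanSpace ℝ (Fin 3))) ∉ B := fun h => hbpdpn (by rw [Finset.pair_comm]; exact h)
  have hcpdp : ({c', d'} : Finset (EuclideanSpace ℝ (Fin 3))) ∈ B :=
    cube_pairing hT hX1 hcard hsepX hB hBcard hdeg hallO hv hN' hd' hcd hab hca hcb hda'' hdb'' hNc hdc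
      hxc' hvxn hvcpn hdxn hdcpn hNd hdd hyd' hvyn hvdpn hcyn hcdpn hNa hda hxa' hvapn hbxn hbapn hNb hdb
      hyb' hvbpn hayn habpn hNx' hdxx' hcap hcpa hcpap hNy' hdyy' hdbp hdpb hdpbp hxX hyX hxv hxc hxd hxa
      hxb hyv hyc hyd hya hyb hxy
  have hcpbp : c' ≠ b' :=
    frame_ne hcard hB hdeg hallO hv hN' hd' hcd hab hca hcb hda'' hdb'' hNc hdc
      hxc' hvxn hvcpn hdxn hdcpn hNd hdd hyd' hvyn hvdpn hcyn hcdpn hNa hda hxa' hvapn hbxn hbapn hNb hdb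
      hyb' hvbpn hayn habpn hNx' hdxx' hcap hcpa hcpap hNy' hdyy' hdbp hdpb hdpbp hxX hyX hxv hxc hxd hxa
      hxb hyv hyc hyd hya hyb hxy
  -- bonds and memberships
  have hva : ({v, a} : Finset (EuclideanSpace ℝ (Fin 3))) ∈ B := (hN a).2 (Or.inl rfl)
  have hvb : ({v, b} : Finset (EuclideanSpace ℝ (Fin 3))) ∈ B := (hN b).2 (Or.inr (Or.inl rfl))
  have hvc : ({v, c} : Finset (EuclideanSpace ℝ (Fin 3))) ∈ B := (hN c).2 (Or.inr (Or.inr (Or.inl rfl)))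
  have hvd : ({v, d} : Finset (EuclideanSpace ℝ (Fin 3))) ∈ B := (hN d).2 (Or.inr (Or.inr (Or.inr rfl)))
  have haa' : ({a, a'} : Finset (EuclideanSpace ℝ (Fin 3))) ∈ B := (hNa a').2 (Or.inr (Or.inr (Or.inr rfl)))
  have hax : ({a, x} : Finset (EuclideanSpace ℝ (Fin 3))) ∈ B := (hNa x).2 (Or.inr (Or.inr (Or.inl rfl)))
  have hbb' : ({b, b'} : Finset (EuclideanSpace ℝ (Fin 3))) ∈ B := (hNb b').2 (Or.inr (Or.inr (Or.inr rfl)))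
  have hby : ({b, y} : Finset (EuclideanSpace ℝ (Fin 3))) ∈ B := (hNb y).2 (Or.inr (Or.inr (Or.inl rfl)))
  have hcc' : ({c, c'} : Finset (EuclideanSpace ℝ (Fin 3))) ∈ B := (hNc c').2 (Or.inr (Or.inr (Or.inr rfl)))
  have hcx : ({c, x} : Finset (EuclideanSpace ℝ (Fin 3))) ∈ B := (hNc x).2 (Or.inr (Or.inr (Or.inl rfl)))
  have hdd' : ({d, d'} : Finset (EuclideanSpace ℝ (Fin 3))) ∈ B := (hNd d').2 (Or.inr (Or.inr (Or.inr rfl)))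
  have hdy : ({d, y} : Finset (EuclideanSpace ℝ (Fin 3))) ∈ B := (hNd y).2 (Or.inr (Or.inr (Or.inl rfl)))
  have haX : a ∈ X := (mem_of_mem_bonds hB hva).2
  have hbX : b ∈ X := (mem_of_mem_bonds hB hvb).2
  have hcX : c ∈ X := (mem_of_mem_bonds hB hvc).2
  have hdX : d ∈ X := (mem_of_mem_bonds hB hvd).2
  have ha'X : a' ∈ X := (mem_of_mem_bonds hB haa').2
  have hb'X : b' ∈ X := (mem_of_mem_bonds hB hbb').2
  have hc'X : c' ∈ X := (mem_of_mem_bonds hB hcc').2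
  have hd'X : d' ∈ X := (mem_of_mem_bonds hB hdd').2
  -- the data at `a'`, `b'`, `c'`, `d'`
  obtain ⟨p1, q1, r1, s1, hN1, hD1, hB11, hB12, hn11, hn12, hn13, hn14⟩ := hallO a' ha'X
  obtain ⟨z, hNap, hdap, -, hbpz, han1, han2, han3, han4⟩ :=
    typeO_complete hN1 hD1 hB11 hB12 hn11 hn12 hn13 hn14 hax (by rw [Finset.pair_comm]; exact haa')
      (by rw [Finset.pair_comm]; exact hxa') hxa.symm hapbp hdb.2.2.2.2.1.symm
      (fun h => habpn (by rw [h]; exact hax))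
  obtain ⟨p2, q2, r2, s2, hN2, hD2, hB21, hB22, hn21, hn22, hn23, hn24⟩ := hallO b' hb'X
  obtain ⟨zb, hNbp, hdbp, -, hapzb, hbn1, hbn2, hbn3, hbn4⟩ :=
    typeO_complete hN2 hD2 hB21 hB22 hn21 hn22 hn23 hn24 hby (by rw [Finset.pair_comm]; exact hbb')
      (by rw [Finset.pair_comm]; exact hyb') hyb.symm (by rw [Finset.pair_comm]; exact hapbp)
      hda.2.2.2.2.1.symm (fun h => hayn (by rw [← h]; exact haa'))
  have hzb : zb = z := by
    rcases (hNap zb).1 hapzb with h | h | h | h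
    · exact absurd (h ▸ (hNbp zb).2 (Or.inr (Or.inr (Or.inr rfl))))
        (fun h' => habpn (by rw [Finset.pair_comm]; exact h'))
    · exact absurd (h ▸ (hNbp zb).2 (Or.inr (Or.inr (Or.inr rfl))))
        (fun h' => han3 (by rw [Finset.pair_comm]; exact h'))
    · exact absurd h (ne_of_mem_bonds hB ((hNbp zb).2 (Or.inr (Or.inr (Or.inr rfl))))).symm
    · exact h
  rw [hzb] at hNbp hdbp hapzb hbn2 hbn4
  obtain ⟨p3, q3, r3, s3, hN3, hD3, hB31, hB32, hn31, hn32, hn33, hn34⟩ := hallO c' hc'X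
  obtain ⟨zc, hNcp, hdcp, -, hdpzc, hcn1, hcn2, hcn3, hcn4⟩ :=
    typeO_complete hN3 hD3 hB31 hB32 hn31 hn32 hn33 hn34 hcx (by rw [Finset.pair_comm]; exact hcc')
      (by rw [Finset.pair_comm]; exact hxc') hxc.symm hcpdp hdd.2.2.2.2.1.symm
      (fun h => hcdpn (by rw [h]; exact hcx))
  obtain ⟨p4, q4, r4, s4, hN4, hD4, hB41, hB42, hn41, hn42, hn43, hn44⟩ := hallO d' hd'X
  obtain ⟨zd, hNdp, hddp, -, hcpzd, hdn1, hdn2, hdn3, hdn4⟩ :=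
    typeO_complete hN4 hD4 hB41 hB42 hn41 hn42 hn43 hn44 hdy (by rw [Finset.pair_comm]; exact hdd')
      (by rw [Finset.pair_comm]; exact hyd') hyd.symm (by rw [Finset.pair_comm]; exact hcpdp)
      hdc.2.2.2.2.1.symm (fun h => hcyn (by rw [← h]; exact hcc'))
  have hzd : zd = zc := by
    rcases (hNcp zd).1 hcpzd with h | h | h | h
    · exact absurd (h ▸ (hNdp zd).2 (Or.inr (Or.inr (Or.inr rfl))))
        (fun h' => hcdpn (by rw [Finset.pair_comm]; exact h'))
    · exact absurd (h ▸ (hNdp zd).2 (Or.inr (Or.inr (Or.inr rfl))))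
        (fun h' => hcn3 (by rw [Finset.pair_comm]; exact h'))
    · exact absurd h (ne_of_mem_bonds hB ((hNdp zd).2 (Or.inr (Or.inr (Or.inr rfl))))).symm
    · exact h
  rw [hzd] at hNdp hddp hcpzd hdn2 hdn4
  -- inequalities
  have hapz : ({a', z} : Finset (EuclideanSpace ℝ (Fin 3))) ∈ B := (hNap z).2 (Or.inr (Or.inr (Or.inr rfl)))
  have hbpz' : ({b', z} : Finset (EuclideanSpace ℝ (Fin 3))) ∈ B := hbpz
  have hzX : z ∈ X := (mem_of_mem_bonds hB hapz).2
  have hzcX : zc ∈ X := (mem_of_mem_bonds hB hdpzc).2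
  have n_v_z : v ≠ z := fun h => hvapn (by rw [h, Finset.pair_comm]; exact hapz)
  have n_z_c : z ≠ c := fun h => hapcn (h ▸ hapz)
  have n_z_d : z ≠ d := fun h => hbpdn (h ▸ hbpz')
  have n_z_cp : z ≠ c' := fun h => hapcpn (h ▸ hapz)
  have n_z_dp : z ≠ d' := fun h => hbpdpn (h ▸ hbpz')
  have n_a_dp : a ≠ d' := fun h => had (by rw [h, Finset.pair_comm]; exact hdd')
  have n_b_cp : b ≠ c' := fun h => hbc (by rw [h, Finset.pair_comm]; exact hcc')
  have n_c_bp : c ≠ b' := fun h => hbc (by rw [h]; exact hbb')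
  have n_d_ap : d ≠ a' := fun h => had (by rw [h]; exact haa')
  have n_ap_bp : a' ≠ b' := ne_of_mem_bonds hB hapbp
  have n_bp_cp : b' ≠ c' := hcpbp.symm
  have n_cp_dp : c' ≠ d' := ne_of_mem_bonds hB hcpdp
  have n_c_x : c ≠ x := hxc.symm
  have n_d_y : d ≠ y := hyd.symm
  have hnd : [v, x, y, z, a, c, b', d', b, d, a', c'].Nodup := by
    simp only [List.nodup_cons, List.mem_cons, List.not_mem_nil, not_or, or_false,
      not_false_eq_true, and_true, List.nodup_nil]
    exact ⟨⟨hda.2.1, hdb.2.1, n_v_z, hdb.1, hdd.1, hdb.2.2.1, hdd.2.2.1, hda.1, hdc.1, hda.2.2.1, hdc.2.2.1⟩, ⟨hxy, hdap.2.2.2.2.1, (hdap.1).symm, (n_c_x).symm, hdap.2.2.2.1, hdcp.2.2.2.1, (hda.2.2.2.1).symm, (hdc.2.2.2.1).symm, hda.2.2.2.2.2, hdc.2.2.2.2.2⟩, ⟨hdbp.2.2.2.2.1, (hdb.2.2.2.1).symm, (hdd.2.2.2.1).symm, hdb.2.2.2.2.2, hdd.2.2.2.2.2, (hdbp.1).symm,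 (n_d_y).symm, hdbp.2.2.2.1, hddp.2.2.2.1⟩, ⟨(hdap.2.2.1).symm, n_z_c, (hdap.2.2.2.2.2).symm, n_z_dp, (hdbp.2.2.1).symm, n_z_d, (hdbp.2.2.2.2.2).symm, n_z_cp⟩, ⟨hd.2.1, hdb.2.2.2.2.1, n_a_dp, hd.1, hd.2.2.1, hdxx.1, hdxx.2.2.1⟩, ⟨n_c_bp, hdd.2.2.2.2.1, (hd.2.2.2.1).symm, hd.2.2.2.2.2, (hdxx.2.2.2.1).symm, hdxx.2.2.2.2.2⟩, ⟨hdyy.2.2.2.2.1, (hdyy.1).symm, hdyy.2.2.2.1, (n_ap_bp).symm, n_bp_cp⟩, ⟨(hdyy.2.2.1).symm, (hdyy.2.2.2.2.2).symm, (hapdp).symm, (n_cp_dp).symm⟩, ⟨hd.2.2.2.2.1, hda.2.2.2.2.1, n_b_cp⟩, ⟨n_d_ap, hdc.2.2.2.2.1⟩, hdxx.2.2.2.2.1⟩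
  have hmemX : ∀ u, u ∈ [v, x, y, z, a, c, b', d', b, d, a', c'] → u ∈ X := by
    intro u hu
    simp only [List.mem_cons, List.not_mem_nil, or_false] at hu
    rcases hu with rfl | rfl | rfl | rfl | rfl | rfl | rfl | rfl | rfl | rfl | rfl | rfl
    exacts [hv, hxX, hyX, hzX, haX, hcX, hb'X, hd'X, hbX, hdX, ha'X, hc'X]
  have hXeq : ∀ u, u ∈ X ↔ u ∈ [v, x, y, z, a, c, b', d', b, d, a', c'] := by
    set L := [v, x, y, z, a, c, b', d', b, d, a', c'] with hL
    have hsub : L.toFinset ⊆ X := fun u hu => hmemX u (List.mem_toFinset.1 hu)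
    have hcardL : L.toFinset.card = 12 := by rw [List.toFinset_card_of_nodup hnd]; rfl
    have heq : L.toFinset = X := Finset.eq_of_subset_of_card_le hsub (by rw [hcard, hcardL])
    intro u
    rw [← heq, List.mem_toFinset]
  -- `zc = z`
  have hczc : ({c', zc} : Finset (EuclideanSpace ℝ (Fin 3))) ∈ B := (hNcp zc).2 (Or.inr (Or.inr (Or.inr rfl)))
  have hzc : zc = z := by
    have hL := (hXeq zc).1 hzcX
    simp only [List.mem_cons, List.not_mem_nil, or_false] at hL
    rcases hL with h | h | h | h | h | h | h | h | h | h | h | h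
    · exact absurd (h ▸ hczc) (fun h' => hvcpn (by rw [Finset.pair_comm]; exact h'))
    · exact absurd h hdcp.2.2.2.2.1.symm
    · exact absurd h hddp.2.2.2.2.1.symm
    · exact h
    · exact absurd (h ▸ hczc) (fun h' => hacpn (by rw [Finset.pair_comm]; exact h'))
    · exact absurd h hdcp.2.2.1.symm
    · exact absurd (h ▸ hdpzc) (fun h' => hbpdpn (by rw [Finset.pair_comm]; exact h'))
    · exact absurd h hdcp.2.2.2.2.2.symm
    · exact absurd (h ▸ hdpzc) (fun h' => hbdpn (by rw [Finset.pair_comm]; exact h'))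
    · exact absurd h hddp.2.2.1.symm
    · exact absurd (h ▸ hczc) (fun h' => hapcpn (by rw [Finset.pair_comm]; exact h'))
    · exact absurd h (ne_of_mem_bonds hB hczc).symm
  rw [hzc] at hNcp hdcp hdpzc hcn2 hcn4 hNdp hddp hcpzd hdn2 hdn4 hczc
  -- the data at `z`
  obtain ⟨p5, q5, r5, s5, hN5, hD5, hB51, hB52, hn51, hn52, hn53, hn54⟩ := hallO z hzX
  obtain ⟨t4, hNz, hdz, -, -, -, -, -, -⟩ :=
    typeO_complete hN5 hD5 hB51 hB52 hn51 hn52 hn53 hn54 hapbp (by rw [Finset.pair_comm]; exact hapz)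
      (by rw [Finset.pair_comm]; exact hbpz') n_ap_bp (by rw [Finset.pair_comm]; exact hczc)
      hdxx.2.2.2.2.1.symm hcpbp
  have hdt : d' = t4 := by
    rcases (hNz d').1 (by rw [Finset.pair_comm]; exact hdpzc) with h | h | h | h
    exacts [absurd h hapdp.symm, absurd h hdyy.2.2.2.2.1.symm, absurd h n_cp_dp.symm, h]
  rw [← hdt] at hNz
  exact ⟨x, y, z, a, c, b', d', b, d, a', c', hnd, hXeq, (fun t => (hN t).trans ⟨by rintro (h | h | h | h); exacts [Or.inl h, Or.inr (Or.inr (Or.inl h)), Or.inr (Or.inl h), Or.inr (Or.inr (Or.inr h))], by rintro (h | h | h | h); exacts [Or.inl h, Or.inr (Or.inr (Or.inl h)), Or.inr (Or.inl h), Or.inr (Or.inr (Or.inr h))]⟩), (fun t => (hNx t).trans ⟨by rintro (h | h | h | h); exacts [Or.inl h, Or.inr (Or.inr (Or.inl h)), Or.inr (Or.inl h), Or.inr (Or.inr (Or.inr h))], by rintro (h | h | h | h); exacts [Or.inl h, Or.inr (Or.inr (Or.inl h)), Or.inr (Or.inl h), Or.inr (Or.inr (Or.inr h))]⟩), (fun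 t => (hNy t).trans ⟨by rintro (h | h | h | h); exacts [Or.inr (Or.inr (Or.inl h)), Or.inl h, Or.inr (Or.inr (Or.inr h)), Or.inr (Or.inl h)], by rintro (h | h | h | h); exacts [Or.inr (Or.inl h), Or.inr (Or.inr (Or.inr h)), Or.inl h, Or.inr (Or.inr (Or.inl h))]⟩), (fun t => (hNz t).trans ⟨by rintro (h | h | h | h); exacts [Or.inr (Or.inr (Or.inl h)), Or.inl h, Or.inr (Or.inr (Or.inr h)), Or.inr (Or.inl h)], by rintro (h | h | h | h); exacts [Or.inr (Or.inl h), Or.inr (Or.inr (Or.inr h)), Or.inl h, Or.inr (Or.inr (Or.inl h))]⟩), (fun t => (hNa t).trans ⟨by rintro (h | h | h | h); exacts [Or.inl h, Or.inr (Or.inr (Or.inl h)), Or.inr (Or.inl h), Or.inr (Or.inr (Or.inr h))], by rintro (h | h | h | h); exacts [Or.inl h, Or.inr (Or.inr (Or.inl h)), Or.inr (Or.inl h), Or.inr (Or.inr (Or.inr h))]⟩), (fun t => (hNc t).trans ⟨by rintro (h | h | h | h); exacts [Or.inl h, Or.inr (Or.inr (Or.inl h)), Or.inr (Or.inl h), Or.inr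 (Or.inr (Or.inr h))], by rintro (h | h | h | h); exacts [Or.inl h, Or.inr (Or.inr (Or.inl h)), Or.inr (Or.inl h), Or.inr (Or.inr (Or.inr h))]⟩), (fun t => (hNbp t).trans ⟨by rintro (h | h | h | h); exacts [Or.inr (Or.inr (Or.inl h)), Or.inl h, Or.inr (Or.inr (Or.inr h)), Or.inr (Or.inl h)], by rintro (h | h | h | h); exacts [Or.inr (Or.inl h), Or.inr (Or.inr (Or.inr h)), Or.inl h, Or.inr (Or.inr (Or.inl h))]⟩), (fun t => (hNdp t).trans ⟨by rintro (h | h | h | h); exacts [Or.inr (Or.inr (Or.inl h)), Or.inl h, Or.inr (Or.inr (Or.inr h)), Or.inr (Or.inl h)], by rintro (h | h | h | h); exacts [Or.inr (Or.inl h), Or.inr (Or.inr (Or.inr h)), Or.inl h, Or.inr (Or.inr (Or.inl h))]⟩), (fun t => (hNb t).trans ⟨by rintro (h | h | h | h); exacts [Or.inl h, Or.inr (Or.inr (Or.inl h)), Or.inr (Or.inl h), Or.inr (Or.inr (Or.inr h))], by rintro (h | h | h | h); exacts [Or.inl h, Or.inr (Or.inr (Or.inl h)), Or.inr (Or.inl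 h), Or.inr (Or.inr (Or.inr h))]⟩), (fun t => (hNd t).trans ⟨by rintro (h | h | h | h); exacts [Or.inl h, Or.inr (Or.inr (Or.inl h)), Or.inr (Or.inl h), Or.inr (Or.inr (Or.inr h))], by rintro (h | h | h | h); exacts [Or.inl h, Or.inr (Or.inr (Or.inl h)), Or.inr (Or.inl h), Or.inr (Or.inr (Or.inr h))]⟩), (fun t => (hNap t).trans ⟨by rintro (h | h | h | h); exacts [Or.inr (Or.inr (Or.inl h)), Or.inl h, Or.inr (Or.inr (Or.inr h)), Or.inr (Or.inl h)], by rintro (h | h | h | h); exacts [Or.inr (Or.inl h), Or.inr (Or.inr (Or.inr h)), Or.inl h, Or.inr (Or.inr (Or.inl h))]⟩), (fun t => (hNcp t).trans ⟨by rintro (h | h | h | h); exacts [Or.inr (Or.inr (Or.inl h)), Or.inl h, Or.inr (Or.inr (Or.inr h)), Or.inr (Or.inl h)], by rintro (h | h | h | h); exacts [Or.inr (Or.inl h), Or.inr (Or.inr (Or.inr h)), Or.inl h, Or.inr (Or.inr (Or.inl h))]⟩)⟩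

end Setting

end Summit.AtomisticToContinuum.Crystallization.Theorems
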